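import Literature.Probability.LatticeModels.SourcedCurrentLaw
import Literature.Probability.LatticeModels.UrsellFourCurrentsProofs
import Literature.Probability.LatticeModels.IntersectionSecondMoment
import HarnessLib

/-!
# Crux `IndependentStrandsJoin` (stmt-CriticalPhenomena-14625), reshape R1 ("single-current second moment") —
# glue stub `stub_secondMomentCurrents`: Paley–Zygmund for the clusters of two independent single currents

Route `FKParityRobustness`, sub-problem `Ising3DConformalLimit`; `--supports` file of the registered glue stub
`stub_secondMomentCurrents` of the reshape skeleton R1 of the line `cross-fattening-decoupling`
(lead `prover-line-stmt-CriticalPhenomena-14625-c1-0`).  The skeleton's vocabulary (`tau`, `sOne`, `sTwo`) is not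
in the tree, so the statement is written INLINED over tree vocabulary:
`τ(x,y) = isingTwoPoint G univ β 0 .free x y`, `P^{xy} = currentLaw G β ({x} ∆ {y})` (the single sourced random
current, `Literature/…/SourcedCurrentLaw.lean`), `𝐂_n(x) = Current.cluster n x`.

**Statement** (`stub_secondMomentCurrents`, every finite graph, `β ≥ 0`, `a : Fin 4 → V`, any finite `B`):

  `U₄(a) · Σ_{u,v ∈ B} P^{a₀a₁}[u,v ∈ 𝐂_{n₁}(a₀)] · P^{a₂a₃}[u,v ∈ 𝐂_{n₂}(a₂)]
     ≤ -2 τ(a₀a₁) τ(a₂a₃) · (Σ_{u ∈ B} P^{a₀a₁}[u ∈ 𝐂_{n₁}(a₀)] · P^{a₂a₃}[u ∈ 𝐂_{n₂}(a₂)])²`,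

`U₄(a) = connectedFour (isingMeasure G univ β 0 .free) spinAt a`.

**Proof.**  Let `n₁ ~ P^{a₀a₁}`, `n₂ ~ P^{a₂a₃}` be INDEPENDENT and `N = #{u ∈ B : u ∈ 𝐂_{n₁}(a₀) ∩ 𝐂_{n₂}(a₂)}`.
(1) The tree's `doubleCurrentMeasure G β A B` IS the product law `P^A ⊗ P^B`: its Dirac weights
`w_{A,B}(p)/(Z_A Z_B)` factor as `P^A{p₁} · P^B{p₂}` (`smc_ofReal_pairWeight_div`, `smc_doubleCurrentMeasure_apply`),
and products of `currentLaw`-masses are series over pairs (`smc_currentLaw_mul_currentLaw`).  Hence both moments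
factorise exactly: `E[N] = Σ_u P₁[u ∈ 𝐂₁] P₂[u ∈ 𝐂₂]` (`smc_firstMoment`) and
`E[N²] = Σ_{u,v} P₁[u,v ∈ 𝐂₁] P₂[u,v ∈ 𝐂₂]` (`smc_secondMoment`), as `ℝ≥0∞` series
`Σ' p, P₁{p₁} P₂{p₂} N(p)^k`.
(2) `{N ≠ 0} ⊆ {a₀ ↔ a₂ in n₁ + n₂} = tracedConn G a₀ a₂` (a common vertex of `𝐂_{n₁}(a₀)` and `𝐂_{n₂}(a₂)` joins
`a₀` to `a₂` in the trace of `n₁ + n₂ ⊇ trace n₁ ∪ trace n₂`; `Current.cluster_mono`) — `smc_indicator_le_conn`.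
(3) Cauchy–Schwarz `E[N]² = E[N 𝟙_{N≠0}]² ≤ P[N ≠ 0] E[N²]` (tree
`Current.tsum_mul_sq_le_tsum_indicator_mul_tsum_sq`, Aizenman–Duminil-Copin 2021, proof of Lemma 4.4).
(4) Aizenman's identity `U₄(a) = -2 τ(a₀a₁) τ(a₂a₃) · P^{a₀a₁} ⊗ P^{a₂a₃}[a₀ ↔ a₂]` (tree
`ursellFour_eq_doubleCurrent_holds`) and `τ ≥ 0` (`τ = Z[xy]/Z[∅]`, `isingTwoPoint_free_eq_currentSum_div_holds`):
`U₄ · E[N²] = -2ττ · P[a₀ ↔ a₂] · E[N²] ≤ -2ττ · P[N ≠ 0] · E[N²] ≤ -2ττ · E[N]²`.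
Degenerate normalisers (no current with the prescribed sources) need no case split: `currentLaw` and
`doubleCurrentMeasure` are then the zero measure and every displayed quantity vanishes (`x/0 = 0`).

Theorem-only file (no new definitions); helper namespace `…Theorems.StubSecondMomentCurrents` (prefix `smc_`).
References: M. Aizenman, Comm. Math. Phys. 86 (1982), Prop. 5.1; M. Aizenman, H. Duminil-Copin, Ann. of Math. 194
(2021), arXiv:1912.07973, eq. (3.11) and §4.2, proof of Lemma 4.4 [AizenmanDuminilCopinAnnals2021];
H. Duminil-Copin, arXiv:1607.06933, Def. 3.2 and eq. (24) [DuminilCopin2016].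
-/

noncomputable section

open Finset SimpleGraph MeasureTheory
open Literature.Probability.LatticeModels
open scoped ENNReal symmDiff

namespace Summit.CriticalPhenomena.Ising3DConformalLimit.Theorems

namespace StubSecondMomentCurrents

open scoped Classical BigOperators

variable {V : Type*} [Fintype V] [DecidableEq V] (G : SimpleGraph V) [DecidableRel G.Adj]

/-- **The double-current weights factorise**: `w_{A,B}(p)/(Z_A Z_B) = P^A{p₁} · P^B{p₂}` in `ℝ≥0∞` (`β ≥ 0`;
both sides vanish when a normaliser does). -/
theorem smc_ofReal_pairWeight_div {β : ℝ} (hβ : 0 ≤ β) (A B : Finset V) (p : Current G × Current G) :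
    ENNReal.ofReal (pairWeight G β A B p / (currentSum G β A * currentSum G β B)) =
      ENNReal.ofReal (currentProb G β A p.1) * ENNReal.ofReal (currentProb G β B p.2) := by
  rw [← ENNReal.ofReal_mul (currentProb_nonneg hβ A p.1)]
  congr 1
  unfold pairWeight currentProb
  rw [div_mul_div_comm]
  congr 1
  by_cases h1 : p.1.sources = A <;> by_cases h2 : p.2.sources = B <;> simp [h1, h2]

/-- **`doubleCurrentMeasure G β A B = P^A ⊗ P^B` on sets**: the mass of any set of pairs is the series of the
product weights `P^A{p₁} P^B{p₂}` over the set (`β ≥ 0`). -/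
theorem smc_doubleCurrentMeasure_apply {β : ℝ} (hβ : 0 ≤ β) (A B : Finset V)
    (S : Set (Current G × Current G)) :
    doubleCurrentMeasure G β A B S =
      ∑' p : Current G × Current G, if p ∈ S then
        ENNReal.ofReal (currentProb G β A p.1) * ENNReal.ofReal (currentProb G β B p.2) else 0 := by
  rw [doubleCurrentMeasure, Measure.sum_apply_of_countable]
  refine tsum_congr fun p => ?_
  rw [Measure.smul_apply, Measure.dirac_apply, smul_eq_mul, smc_ofReal_pairWeight_div G hβ]
  by_cases hp : p ∈ S <;> simp [hp]

/-- Products of single-current masses as a series over pairs: `P^A[S] · P^B[T] = Σ_{(p₁,p₂) ∈ S × T} P^A{p₁} P^B{p₂}`. -/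
theorem smc_currentLaw_mul_currentLaw (β : ℝ) (A B : Finset V) (S T : Set (Current G)) :
    currentLaw G β A S * currentLaw G β B T =
      ∑' p : Current G × Current G,
        (if p.1 ∈ S then ENNReal.ofReal (currentProb G β A p.1) else 0) *
          (if p.2 ∈ T then ENNReal.ofReal (currentProb G β B p.2) else 0) := by
  rw [currentLaw_apply, currentLaw_apply, tsum_mul_tsum_eq_tsum_prod]

/-- The total mass of `P^A` is finite (`β ≥ 0`; it is `1` or, in the degenerate case, `0`). -/
theorem smc_currentLaw_univ_ne_top {β : ℝ} (hβ : 0 ≤ β) (A : Finset V) :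
    currentLaw G β A Set.univ ≠ ∞ := by
  rw [currentLaw_apply]
  simp only [Set.mem_univ, if_true]
  rw [← ENNReal.ofReal_tsum_of_nonneg (currentProb_nonneg hβ A) (summable_currentProb G β A)]
  exact ENNReal.ofReal_ne_top

/-- Every `P^A`-mass is finite (`β ≥ 0`). -/
theorem smc_currentLaw_ne_top {β : ℝ} (hβ : 0 ≤ β) (A : Finset V) (S : Set (Current G)) :
    currentLaw G β A S ≠ ∞ :=
  ne_top_of_le_ne_top (smc_currentLaw_univ_ne_top G hβ A) (measure_mono (Set.subset_univ S))

/-- Every `P^A ⊗ P^B`-mass is finite (`β ≥ 0`). -/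
theorem smc_doubleCurrentMeasure_ne_top {β : ℝ} (hβ : 0 ≤ β) (A B : Finset V)
    (S : Set (Current G × Current G)) : doubleCurrentMeasure G β A B S ≠ ∞ := by
  refine ne_top_of_le_ne_top ?_ (measure_mono (Set.subset_univ S))
  rw [smc_doubleCurrentMeasure_apply G hβ A B Set.univ]
  simp only [Set.mem_univ, if_true]
  rw [← tsum_mul_tsum_eq_tsum_prod (fun n => ENNReal.ofReal (currentProb G β A n))
    (fun n => ENNReal.ofReal (currentProb G β B n))]
  have h : ∀ C : Finset V, (∑' n : Current G, ENNReal.ofReal (currentProb G β C n)) ≠ ∞ := fun C => by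
    rw [← ENNReal.ofReal_tsum_of_nonneg (currentProb_nonneg hβ C) (summable_currentProb G β C)]
    exact ENNReal.ofReal_ne_top
  exact ENNReal.mul_ne_top (h A) (h B)

omit [DecidableEq V] in
/-- **Meeting clusters connect the sources**: if `u ∈ 𝐂_{p₁}(x)` and `u ∈ 𝐂_{p₂}(z)` then `x ↔ z` in the trace
of `p₁ + p₂` (both traces are contained in it, `Current.cluster_mono`). -/
theorem smc_mem_tracedConn_of_mem_cluster {x z u : V} {p : Current G × Current G}
    (h1 : u ∈ p.1.cluster x) (h2 : u ∈ p.2.cluster z) : p ∈ tracedConn G x z := by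
  rw [mem_tracedConn_iff, ← Current.mem_cluster_iff]
  have h1' : u ∈ (p.1 + p.2).cluster x := Current.cluster_mono (self_le_add_right p.1 p.2) _ h1
  have h2' : u ∈ (p.1 + p.2).cluster z := Current.cluster_mono (self_le_add_left p.2 p.1) _ h2
  exact Current.mem_cluster_trans h1' (Current.mem_cluster_comm.1 h2')

/-- **First moment factorised** (`ℝ≥0∞`): `Σ_{u ∈ B} P^A[u ∈ 𝐂(x)] · P^C[u ∈ 𝐂(z)] = Σ' p, P^A{p₁} P^C{p₂} · N(p)`,
`N(p) = #{u ∈ B : u ∈ 𝐂_{p₁}(x) ∩ 𝐂_{p₂}(z)}` — `E[N]` under `P^A ⊗ P^C` by Fubini. -/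
theorem smc_firstMoment_enn (β : ℝ) (A C : Finset V) (x z : V) (B : Finset V) :
    ∑ u ∈ B, currentLaw G β A {n | u ∈ n.cluster x} * currentLaw G β C {n | u ∈ n.cluster z} =
      ∑' p : Current G × Current G,
        ENNReal.ofReal (currentProb G β A p.1) * ENNReal.ofReal (currentProb G β C p.2) *
          ∑ u ∈ B, (if u ∈ p.1.cluster x ∧ u ∈ p.2.cluster z then (1 : ℝ≥0∞) else 0) := by
  simp_rw [Finset.mul_sum]
  rw [Summable.tsum_finsetSum (fun _ _ => ENNReal.summable)]
  refine Finset.sum_congr rfl fun u _ => ?_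
  rw [smc_currentLaw_mul_currentLaw]
  refine tsum_congr fun p => ?_
  by_cases h1 : u ∈ p.1.cluster x <;> by_cases h2 : u ∈ p.2.cluster z <;> simp [h1, h2]

/-- **Second moment factorised** (`ℝ≥0∞`):
`Σ_{u,v ∈ B} P^A[u,v ∈ 𝐂(x)] · P^C[u,v ∈ 𝐂(z)] = Σ' p, P^A{p₁} P^C{p₂} · N(p)²` — `E[N²]` under `P^A ⊗ P^C`. -/
theorem smc_secondMoment_enn (β : ℝ) (A C : Finset V) (x z : V) (B : Finset V) :
    ∑ u ∈ B, ∑ v ∈ B, currentLaw G β A {n | u ∈ n.cluster x ∧ v ∈ n.cluster x} *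
        currentLaw G β C {n | u ∈ n.cluster z ∧ v ∈ n.cluster z} =
      ∑' p : Current G × Current G,
        ENNReal.ofReal (currentProb G β A p.1) * ENNReal.ofReal (currentProb G β C p.2) *
          (∑ u ∈ B, (if u ∈ p.1.cluster x ∧ u ∈ p.2.cluster z then (1 : ℝ≥0∞) else 0)) ^ 2 := by
  have hsq : ∀ p : Current G × Current G,
      ENNReal.ofReal (currentProb G β A p.1) * ENNReal.ofReal (currentProb G β C p.2) *
          (∑ u ∈ B, (if u ∈ p.1.cluster x ∧ u ∈ p.2.cluster z then (1 : ℝ≥0∞) else 0)) ^ 2 =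
        ∑ u ∈ B, ∑ v ∈ B,
          ENNReal.ofReal (currentProb G β A p.1) * ENNReal.ofReal (currentProb G β C p.2) *
            ((if u ∈ p.1.cluster x ∧ u ∈ p.2.cluster z then (1 : ℝ≥0∞) else 0) *
              (if v ∈ p.1.cluster x ∧ v ∈ p.2.cluster z then (1 : ℝ≥0∞) else 0)) := fun p => by
    rw [sq, Finset.sum_mul_sum, Finset.mul_sum]
    refine Finset.sum_congr rfl fun u _ => ?_
    rw [Finset.mul_sum]
  simp_rw [hsq]
  rw [Summable.tsum_finsetSum (fun _ _ => ENNReal.summable)]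
  refine Finset.sum_congr rfl fun u _ => ?_
  rw [Summable.tsum_finsetSum (fun _ _ => ENNReal.summable)]
  refine Finset.sum_congr rfl fun v _ => ?_
  rw [smc_currentLaw_mul_currentLaw]
  refine tsum_congr fun p => ?_
  by_cases h1 : u ∈ p.1.cluster x <;> by_cases h2 : v ∈ p.1.cluster x <;>
    by_cases h3 : u ∈ p.2.cluster z <;> by_cases h4 : v ∈ p.2.cluster z <;> simp [h1, h2, h3, h4]

/-- **First moment factorised**, real form: `E₁ = Σ_{u ∈ B} P^A[u ∈ 𝐂(x)] P^C[u ∈ 𝐂(z)] = (Σ' P P N).toReal`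
(`β ≥ 0`). -/
theorem smc_firstMoment {β : ℝ} (hβ : 0 ≤ β) (A C : Finset V) (x z : V) (B : Finset V) :
    ∑ u ∈ B, (currentLaw G β A).real {n | u ∈ n.cluster x} * (currentLaw G β C).real {n | u ∈ n.cluster z} =
      (∑' p : Current G × Current G,
        ENNReal.ofReal (currentProb G β A p.1) * ENNReal.ofReal (currentProb G β C p.2) *
          ∑ u ∈ B, (if u ∈ p.1.cluster x ∧ u ∈ p.2.cluster z then (1 : ℝ≥0∞) else 0)).toReal := by
  rw [← smc_firstMoment_enn, ENNReal.toReal_sum (fun u _ =>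
    ENNReal.mul_ne_top (smc_currentLaw_ne_top G hβ A _) (smc_currentLaw_ne_top G hβ C _))]
  refine Finset.sum_congr rfl fun u _ => ?_
  rw [measureReal_def, measureReal_def, ENNReal.toReal_mul]

/-- **Second moment factorised**, real form:
`E₂ = Σ_{u,v ∈ B} P^A[u,v ∈ 𝐂(x)] P^C[u,v ∈ 𝐂(z)] = (Σ' P P N²).toReal` (`β ≥ 0`). -/
theorem smc_secondMoment {β : ℝ} (hβ : 0 ≤ β) (A C : Finset V) (x z : V) (B : Finset V) :
    ∑ u ∈ B, ∑ v ∈ B, (currentLaw G β A).real {n | u ∈ n.cluster x ∧ v ∈ n.cluster x} *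
        (currentLaw G β C).real {n | u ∈ n.cluster z ∧ v ∈ n.cluster z} =
      (∑' p : Current G × Current G,
        ENNReal.ofReal (currentProb G β A p.1) * ENNReal.ofReal (currentProb G β C p.2) *
          (∑ u ∈ B, (if u ∈ p.1.cluster x ∧ u ∈ p.2.cluster z then (1 : ℝ≥0∞) else 0)) ^ 2).toReal := by
  have hfin : ∀ u v : V, currentLaw G β A {n | u ∈ n.cluster x ∧ v ∈ n.cluster x} *
      currentLaw G β C {n | u ∈ n.cluster z ∧ v ∈ n.cluster z} ≠ ∞ := fun u v =>
    ENNReal.mul_ne_top (smc_currentLaw_ne_top G hβ A _) (smc_currentLaw_ne_top G hβ C _)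
  rw [← smc_secondMoment_enn, ENNReal.toReal_sum (fun u _ => ENNReal.sum_ne_top.2 fun v _ => hfin u v)]
  refine Finset.sum_congr rfl fun u _ => ?_
  rw [ENNReal.toReal_sum (fun v _ => hfin u v)]
  refine Finset.sum_congr rfl fun v _ => ?_
  rw [measureReal_def, measureReal_def, ENNReal.toReal_mul]

/-- The second moment series is finite (`β ≥ 0`). -/
theorem smc_secondMoment_ne_top {β : ℝ} (hβ : 0 ≤ β) (A C : Finset V) (x z : V) (B : Finset V) :
    (∑' p : Current G × Current G,
        ENNReal.ofReal (currentProb G β A p.1) * ENNReal.ofReal (currentProb G β C p.2) *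
          (∑ u ∈ B, (if u ∈ p.1.cluster x ∧ u ∈ p.2.cluster z then (1 : ℝ≥0∞) else 0)) ^ 2) ≠ ∞ := by
  rw [← smc_secondMoment_enn]
  exact ENNReal.sum_ne_top.2 fun u _ => ENNReal.sum_ne_top.2 fun v _ =>
    ENNReal.mul_ne_top (smc_currentLaw_ne_top G hβ A _) (smc_currentLaw_ne_top G hβ C _)

/-- **`{N ≠ 0} ⊆ {x ↔ z in n₁ + n₂}`** in weighted form:
`Σ' p, P^A{p₁} P^C{p₂} 𝟙[N(p) ≠ 0] ≤ P^A ⊗ P^C [tracedConn G x z]` (`β ≥ 0`). -/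
theorem smc_indicator_le_conn {β : ℝ} (hβ : 0 ≤ β) (A C : Finset V) (x z : V) (B : Finset V) :
    (∑' p : Current G × Current G,
        ENNReal.ofReal (currentProb G β A p.1) * ENNReal.ofReal (currentProb G β C p.2) *
          (if (∑ u ∈ B, (if u ∈ p.1.cluster x ∧ u ∈ p.2.cluster z then (1 : ℝ≥0∞) else 0)) = 0
            then 0 else 1)) ≤
      doubleCurrentMeasure G β A C (tracedConn G x z) := by
  rw [smc_doubleCurrentMeasure_apply G hβ]
  refine ENNReal.tsum_le_tsum fun p => ?_
  by_cases hN : (∑ u ∈ B, (if u ∈ p.1.cluster x ∧ u ∈ p.2.cluster z then (1 : ℝ≥0∞) else 0)) = 0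
  · rw [if_pos hN, mul_zero]
    exact bot_le
  · obtain ⟨u, -, hu⟩ := Finset.exists_ne_zero_of_sum_ne_zero hN
    have hmem : u ∈ p.1.cluster x ∧ u ∈ p.2.cluster z := by
      by_contra h
      exact hu (if_neg h)
    rw [if_neg hN, mul_one, if_pos (smc_mem_tracedConn_of_mem_cluster G hmem.1 hmem.2)]

/-- **The second-moment inequality in real form**: `E₁² ≤ P^A ⊗ P^C[x ↔ z] · E₂` (`β ≥ 0`), from
Cauchy–Schwarz `E[N]² ≤ P[N ≠ 0] E[N²]` and `{N ≠ 0} ⊆ {x ↔ z}`. -/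
theorem smc_firstMoment_sq_le {β : ℝ} (hβ : 0 ≤ β) (A C : Finset V) (x z : V) (B : Finset V) :
    (∑ u ∈ B, (currentLaw G β A).real {n | u ∈ n.cluster x} * (currentLaw G β C).real {n | u ∈ n.cluster z}) ^ 2 ≤
      (doubleCurrentMeasure G β A C).real (tracedConn G x z) *
        ∑ u ∈ B, ∑ v ∈ B, (currentLaw G β A).real {n | u ∈ n.cluster x ∧ v ∈ n.cluster x} *
          (currentLaw G β C).real {n | u ∈ n.cluster z ∧ v ∈ n.cluster z} := by
  rw [smc_firstMoment G hβ, smc_secondMoment G hβ, measureReal_def, ← ENNReal.toReal_pow,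
    ← ENNReal.toReal_mul]
  refine ENNReal.toReal_mono
    (ENNReal.mul_ne_top (smc_doubleCurrentMeasure_ne_top G hβ A C _) (smc_secondMoment_ne_top G hβ A C x z B)) ?_
  refine (Current.tsum_mul_sq_le_tsum_indicator_mul_tsum_sq
    (fun p : Current G × Current G =>
      ENNReal.ofReal (currentProb G β A p.1) * ENNReal.ofReal (currentProb G β C p.2))
    (fun p : Current G × Current G =>
      ∑ u ∈ B, (if u ∈ p.1.cluster x ∧ u ∈ p.2.cluster z then (1 : ℝ≥0∞) else 0))).trans ?_
  exact mul_le_mul' (smc_indicator_le_conn G hβ A C x z B) le_rfl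

/-- `τ(x,y) = ⟨σ_xσ_y⟩^free ≥ 0` for `β ≥ 0` (Griffiths I, here from `τ = Z[{x}∆{y}]/Z[∅]`). -/
theorem smc_isingTwoPoint_nonneg {β : ℝ} (hβ : 0 ≤ β) (x y : V) :
    0 ≤ isingTwoPoint G univ β 0 .free x y := by
  rw [isingTwoPoint_free_eq_currentSum_div_holds G β x y]
  exact div_nonneg (currentSum_nonneg G hβ _) (currentSum_nonneg G hβ _)

/-- Aizenman's identity for a general `a : Fin 4 → V` (the tree's `ursellFour_eq_doubleCurrent_holds` is stated
for `![x, y, z, t]`): `U₄(a) = -2 τ(a₀a₁) τ(a₂a₃) · P^{a₀a₁} ⊗ P^{a₂a₃}[a₀ ↔ a₂]`. -/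
theorem smc_connectedFour_eq {β : ℝ} (hβ : 0 ≤ β) (a : Fin 4 → V) :
    connectedFour (isingMeasure G univ β 0 .free) spinAt a =
      -2 * isingTwoPoint G univ β 0 .free (a 0) (a 1) * isingTwoPoint G univ β 0 .free (a 2) (a 3) *
        (doubleCurrentMeasure G β ({a 0} ∆ {a 1}) ({a 2} ∆ {a 3})).real (tracedConn G (a 0) (a 2)) := by
  have ha : (![a 0, a 1, a 2, a 3] : Fin 4 → V) = a := by
    funext i
    fin_cases i <;> rfl
  have h := ursellFour_eq_doubleCurrent_holds G hβ (a 0) (a 1) (a 2) (a 3)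
  rwa [ha] at h

end StubSecondMomentCurrents

/-- **Registered glue stub `stub_secondMomentCurrents` of the reshape skeleton R1 ("single-current second moment") of
crux `IndependentStrandsJoin` (stmt-CriticalPhenomena-14625)** — the Paley–Zygmund lower bound on `|U₄|` through the
clusters of two INDEPENDENT single sourced currents, on every finite graph, `β ≥ 0`, any `a : Fin 4 → V` and finite `B`:
`U₄(a) · E₂ ≤ -2 τ(a₀a₁) τ(a₂a₃) · E₁²` with the factorised moments
`E₁ = Σ_{u ∈ B} P^{a₀a₁}[u ∈ 𝐂_{n₁}(a₀)] P^{a₂a₃}[u ∈ 𝐂_{n₂}(a₂)]`,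
`E₂ = Σ_{u,v ∈ B} P^{a₀a₁}[u,v ∈ 𝐂_{n₁}(a₀)] P^{a₂a₃}[u,v ∈ 𝐂_{n₂}(a₂)]`
(Aizenman's identity `ursellFour_eq_doubleCurrent_holds` + `{𝐂₁ ∩ 𝐂₂ ∩ B ≠ ∅} ⊆ {a₀ ↔ a₂ in n₁ + n₂}` +
Cauchy–Schwarz under the product law `doubleCurrentMeasure = P^{a₀a₁} ⊗ P^{a₂a₃}`).  Injectivity of `a` is part
of the registered signature but not needed. -/
theorem stub_secondMomentCurrents :
    ∀ (V : Type) [Fintype V] [DecidableEq V] (G : SimpleGraph V) [DecidableRel G.Adj] (β : ℝ), 0 ≤ β →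
      ∀ a : Fin 4 → V, Function.Injective a → ∀ B : Finset V,
        connectedFour (isingMeasure G Finset.univ β 0 .free) spinAt a *
            (∑ u ∈ B, ∑ v ∈ B,
              (currentLaw G β ({a 0} ∆ {a 1})).real {n | u ∈ n.cluster (a 0) ∧ v ∈ n.cluster (a 0)} *
              (currentLaw G β ({a 2} ∆ {a 3})).real {n | u ∈ n.cluster (a 2) ∧ v ∈ n.cluster (a 2)})
          ≤ -(2 * isingTwoPoint G Finset.univ β 0 .free (a 0) (a 1) *
                isingTwoPoint G Finset.univ β 0 .free (a 2) (a 3) *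
              (∑ u ∈ B, (currentLaw G β ({a 0} ∆ {a 1})).real {n | u ∈ n.cluster (a 0)} *
                (currentLaw G β ({a 2} ∆ {a 3})).real {n | u ∈ n.cluster (a 2)}) ^ 2) := by
  intro V _ _ G _ β hβ a _ B
  have hSM := StubSecondMomentCurrents.smc_firstMoment_sq_le G hβ ({a 0} ∆ {a 1}) ({a 2} ∆ {a 3}) (a 0) (a 2) B
  have hτ : 0 ≤ isingTwoPoint G univ β 0 .free (a 0) (a 1) * isingTwoPoint G univ β 0 .free (a 2) (a 3) :=
    mul_nonneg (StubSecondMomentCurrents.smc_isingTwoPoint_nonneg G hβ _ _)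
      (StubSecondMomentCurrents.smc_isingTwoPoint_nonneg G hβ _ _)
  have key := mul_le_mul_of_nonneg_left hSM hτ
  rw [StubSecondMomentCurrents.smc_connectedFour_eq G hβ a]
  nlinarith [key]

end Summit.CriticalPhenomena.Ising3DConformalLimit.Theorems

end
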